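import Summits.HodgeConjecture.HodgeConjecture.Theorems.PadicSemiregularLiftFormalLiftingFromClassLiftingGlue

/-!
# `FormalLiftingFromClassLifting` (stmt-HodgeConjecture-13825) · line `hu` · the `K₀`-tower algebra of both stubs

Crux P1a of route `PadicSemiregularLift` is, through the landed glue
(`Theorems/PadicSemiregularLiftFormalLiftingFromClassLiftingGlue.lean`), the conjunction of two closed
`K₀`-statements on the `p`-adic tower `X_1 ⟶ X_2 ⟶ ⋯` of a smooth projective `𝒳/W(k)`
(`X_n = WittScheme.thickening 𝒳 n = 𝒳 ⊗ W/pⁿ`, `X_k ⟶ X_{n+1}` = `specialFibreToThickening 𝒳 n`):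

* (2_K) KERNEL TOWER (`stub_kernelTower`): a class on `X_{n+1}` dying on `X_k` is the restriction of a
  class on `X_{n+2}` dying on `X_k`;
* level-wise (1_K) (`stub_levelwiseClassLift`): a class `y ∈ K₀(X_k)` some non-zero multiple of which
  lifts to every level (clearing the denominators of the crux's rational pro-class,
  `Negative.exists_int_multiple_lifts_all_levels`) itself lifts to every level.

On paper both follow from X. Hu, *On the algebraic K-theory of smooth schemes over truncated Witt
vectors*, arXiv:2507.12458 (2025): Cor. 10.5 (i) (`i = 0`: the relative Chern character
`K₀(X_N, X_1) ≅ ⊕_r ℍ^{2r-1}(X_1, p(r)Ω•_{X_N})`, natural in `N` by Prop. 9.6 (ii), whose image in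
`K₀(X_N)` is `ker(K₀(X_N) → K₀(X_1))`) and Prop. 11.1 (i) (`(m,n) = (1,N)`: `ξ ∈ K₀(X_1)` lifts to
`K₀(X_N)` iff a Hodge obstruction `ob_{1,N}(ξ) ∈ ⊕_r ℍ^{2r}(X_1, p(r)Ω•_{X_N})` vanishes, compatible in
`N`), together with two COHERENT lattice lemmas under torsion-free Hodge cohomology: the transition
maps of the odd hypercohomology groups are onto, and a compatible family of even classes killed by a
non-zero integer vanishes.

This file proves, sorry-free and over tree vocabulary only, the `K₀`-TOWER ALGEBRA that turns such
data into the two stubs — with the K-theoretic inputs as universally quantified DATA (groups `S N`,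
`Ob N`, maps `ρ`, `ob`, `red` and their exactness / naturality / lattice properties as hypotheses), so
that the stubs close by instantiating the data with the named facts and the lattice lemmas once the
p-adic de Rham carrier lands:

* `kernelTower_of_naturalSurjections` — natural maps `ρ N : S N → K₀(X_{N+2})` onto
  `ker(K₀(X_{N+2}) → K₀(X_1))` with surjective transitions `red N : S (N+1) ↠ S N` give (2_K);
* `levelwiseLift_of_obstructionData` — obstruction maps `ob N : K₀(X_1) → Ob N` with
  `ker (ob N) = im(K₀(X_{N+2}) → K₀(X_1))`, compatible along `red N : Ob (N+1) → Ob N`, on a tower in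
  which compatible families killed by a non-zero integer vanish, give level-wise lifting of every class
  a non-zero multiple of which lifts to all levels.

Level `0` of both is free (`X_k ⥲ X_1` for `k` perfect: `Negative.isIso_specialFibreToThickening_zero'`,
`Negative.exists_lift_level_zero`, `Negative.kernelTowerSurjective_level_zero`, landed). Nothing here
uses smoothness, properness, projectivity, a bound on `p` or torsion-freeness: those enter only through
the data. These are implications with universally quantified data, not axiomatised towers asserted to
exist (cf. `Negative/ObstructionTowerDecoration`).
-/

set_option linter.dupNamespace false

namespace Summit.HodgeConjecture.HodgeConjecture.Theorems.FormalLiftingFromClassLifting.HuLine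

open CategoryTheory AlgebraicGeometry Limits
open Literature.AlgebraicGeometry Literature.AlgebraicGeometry.Motives
open Literature.AlgebraicGeometry.Motives.WittScheme
open Summit.HodgeConjecture.HodgeConjecture.Theorems.FormalLiftingFromClassLifting.Negative
  (specialFibreToThickening_comp_thickeningMap isIso_specialFibreToThickening_zero'
    exists_lift_level_zero kernelTowerSurjective_level_zero)
noncomputable section

/-! ## Restriction to `X_k` through `X_1` -/

section Restriction

variable {p : ℕ} [Fact p.Prime] {k : Type} [Field k] [CharP k p] [PerfectRing k p]
  (𝒳 : SchemeOver (WittVector p k))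

/-- A class on `X_{N+2}` dies on `X_k` iff it dies on `X_1` (`X_k ⟶ X_{N+2}` factors through the
isomorphism `X_k ⥲ X_1`). [folklore] -/
theorem map_specialFibreToThickening_eq_zero_iff (N : ℕ)
    (t : KTheory.KZero (thickening 𝒳 (N + 2)).left) :
    KTheory.KZero.map (specialFibreToThickening 𝒳 (N + 1)) t = 0 ↔
      KTheory.KZero.map (thickeningMap 𝒳 (Nat.le_add_left 1 (N + 1))) t = 0 := by
  haveI := isIso_specialFibreToThickening_zero' 𝒳
  rw [← specialFibreToThickening_comp_thickeningMap 𝒳 (Nat.le_add_left 1 (N + 1)),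
    KTheory.KZero.map_comp_apply]
  refine ⟨fun h => ?_, fun h => by rw [h, map_zero]⟩
  have h' := congrArg (KTheory.KZero.map (inv (specialFibreToThickening 𝒳 0))) h
  rwa [← KTheory.KZero.map_comp_apply, IsIso.inv_hom_id, KTheory.KZero.map_id,
    AddMonoidHom.id_apply, map_zero] at h'

/-- `K₀(X_1) → K₀(X_k)` is injective (`X_k ⥲ X_1`). [folklore] -/
theorem map_specialFibreToThickening_zero_injective :
    Function.Injective (KTheory.KZero.map (specialFibreToThickening 𝒳 0)) := by
  haveI := isIso_specialFibreToThickening_zero' 𝒳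
  intro a b h
  have h' := congrArg (KTheory.KZero.map (inv (specialFibreToThickening 𝒳 0))) h
  rwa [← KTheory.KZero.map_comp_apply, ← KTheory.KZero.map_comp_apply, IsIso.inv_hom_id,
    KTheory.KZero.map_id, AddMonoidHom.id_apply, AddMonoidHom.id_apply] at h'

end Restriction

/-! ## (2_K) from natural surjections onto the kernels -/

/-- **Kernel tower from natural surjections onto the kernels.** Let `S N` be abelian groups with
additive maps `ρ N : S N → K₀(X_{N+2})` whose image is EXACTLY `ker(K₀(X_{N+2}) → K₀(X_1))`
(`hker`, `hrange`), natural along transitions `red N : S (N+1) → S N` of the tower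
(`ρ N ∘ red N = (X_{N+2} ⟶ X_{N+3})^* ∘ ρ (N+1)`, `hnat`), with every `red N` surjective (`hred`).
Then the kernel tower of `𝒳` is surjective: every class on `X_{n+1}` dying on `X_k` is the restriction
of a class on `X_{n+2}` dying on `X_k` (verbatim the conclusion of `stub_kernelTower`). On paper
`S N = ⊕_{r=1}^{d} ℍ^{2r-1}(X_1, p(r)Ω•_{X_{N+2}})` and `ρ N` = (inclusion of the relative term) ∘ ch⁻¹
(X. Hu, arXiv:2507.12458, Cor. 10.5 (i), Prop. 9.6 (ii)); surjectivity of `red N` is the coherent lattice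
lemma. Level `0` is free (`Negative.kernelTowerSurjective_level_zero`). [folklore] -/
theorem kernelTower_of_naturalSurjections :
    ∀ (p : ℕ) [Fact p.Prime] (k : Type) [Field k] [CharP k p] [PerfectRing k p]
      (𝒳 : SchemeOver (WittVector p k)) (S : ℕ → Type) [∀ N, AddCommGroup (S N)]
      (ρ : ∀ N, S N →+ KTheory.KZero (thickening 𝒳 (N + 2)).left) (red : ∀ N, S (N + 1) →+ S N),
      (∀ (N : ℕ) (s : S N),
        KTheory.KZero.map (thickeningMap 𝒳 (Nat.le_add_left 1 (N + 1))) (ρ N s) = 0) →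
      (∀ (N : ℕ) (t : KTheory.KZero (thickening 𝒳 (N + 2)).left),
        KTheory.KZero.map (thickeningMap 𝒳 (Nat.le_add_left 1 (N + 1))) t = 0 → ∃ s : S N, ρ N s = t) →
      (∀ (N : ℕ) (s : S (N + 1)),
        KTheory.KZero.map (thickeningMap 𝒳 (Nat.le_succ (N + 2))) (ρ (N + 1) s) = ρ N (red N s)) →
      (∀ N, Function.Surjective (red N)) →
      ∀ (n : ℕ) (t : KTheory.KZero (thickening 𝒳 (n + 1)).left),
        KTheory.KZero.map (specialFibreToThickening 𝒳 n) t = 0 →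
        ∃ t' : KTheory.KZero (thickening 𝒳 (n + 2)).left,
          KTheory.KZero.map (specialFibreToThickening 𝒳 (n + 1)) t' = 0 ∧
          KTheory.KZero.map (thickeningMap 𝒳 (Nat.le_succ (n + 1))) t' = t := by
  intro p _ k _ _ _ 𝒳 S _ ρ red hker hrange hnat hred n
  cases n with
  | zero => exact kernelTowerSurjective_level_zero 𝒳
  | succ N =>
    intro t ht
    rw [map_specialFibreToThickening_eq_zero_iff] at ht
    obtain ⟨s, rfl⟩ := hrange N t ht
    obtain ⟨s', rfl⟩ := hred N s
    refine ⟨ρ (N + 1) s', ?_, hnat N s'⟩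
    rw [map_specialFibreToThickening_eq_zero_iff]
    exact hker (N + 1) s'

/-! ## Level-wise (1_K) from compatible obstruction maps with exact kernels -/

/-- **Level-wise lifting from obstruction data.** Let `Ob N` be abelian groups with additive maps
`ob N : K₀(X_1) → Ob N` whose kernel is EXACTLY `im(K₀(X_{N+2}) → K₀(X_1))` (`hexact`, `hzero`),
compatible along transitions `red N : Ob (N+1) → Ob N` (`red N ∘ ob (N+1) = ob N`, `hcompat`), and
assume that on the tower `(Ob, red)` every compatible family killed by a non-zero integer vanishes
(`hP`). Then every class `y ∈ K₀(X_k)` a non-zero integer multiple of which lifts to every level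
(`hM`) lifts to every level (verbatim the conclusion of `stub_levelwiseClassLift` for `y = [E₁]`, whose
`hM` is `Negative.exists_int_multiple_lifts_all_levels`). On paper `Ob N = ⊕_{r=1}^{d-1} ℍ^{2r}(X_1,
p(r)Ω•_{X_{N+2}})`, `ob N = ob_{1,N+2}` (X. Hu, arXiv:2507.12458, Prop. 11.1 (i), Prop. 9.6), and `hP`
is the coherent lattice lemma (torsion-free Hodge cohomology). Level `0` is free
(`Negative.exists_lift_level_zero`). [folklore] -/
theorem levelwiseLift_of_obstructionData :
    ∀ (p : ℕ) [Fact p.Prime] (k : Type) [Field k] [CharP k p] [PerfectRing k p]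
      (𝒳 : SchemeOver (WittVector p k)) (Ob : ℕ → Type) [∀ N, AddCommGroup (Ob N)]
      (ob : ∀ N, KTheory.KZero (thickening 𝒳 1).left →+ Ob N) (red : ∀ N, Ob (N + 1) →+ Ob N),
      (∀ (N : ℕ) (x : KTheory.KZero (thickening 𝒳 1).left), ob N x = 0 →
        ∃ z : KTheory.KZero (thickening 𝒳 (N + 2)).left,
          KTheory.KZero.map (thickeningMap 𝒳 (Nat.le_add_left 1 (N + 1))) z = x) →
      (∀ (N : ℕ) (z : KTheory.KZero (thickening 𝒳 (N + 2)).left),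
        ob N (KTheory.KZero.map (thickeningMap 𝒳 (Nat.le_add_left 1 (N + 1))) z) = 0) →
      (∀ (N : ℕ) (x : KTheory.KZero (thickening 𝒳 1).left), red N (ob (N + 1) x) = ob N x) →
      (∀ (L : ℤ), L ≠ 0 → ∀ o : (∀ N, Ob N), (∀ N, red N (o (N + 1)) = o N) →
        (∀ N, L • o N = 0) → ∀ N, o N = 0) →
      ∀ (y : KTheory.KZero (specialFibre 𝒳).left),
        (∃ M : ℤ, M ≠ 0 ∧ ∀ n : ℕ, ∃ z : KTheory.KZero (thickening 𝒳 (n + 1)).left,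
          KTheory.KZero.map (specialFibreToThickening 𝒳 n) z = M • y) →
        ∀ n : ℕ, ∃ z : KTheory.KZero (thickening 𝒳 (n + 1)).left,
          KTheory.KZero.map (specialFibreToThickening 𝒳 n) z = y := by
  intro p _ k _ _ _ 𝒳 Ob _ ob red hexact hzero hcompat hP y hM
  -- transport `y` to `X_1` along the isomorphism `X_k ⥲ X_1`
  obtain ⟨y₁, hy₁⟩ := exists_lift_level_zero 𝒳 y
  obtain ⟨M, hM0, hM⟩ := hM
  -- `M • y₁ ∈ im(K₀(X_{N+2}) → K₀(X_1))` for every `N`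
  have hMy : ∀ N : ℕ, ∃ z : KTheory.KZero (thickening 𝒳 (N + 2)).left,
      KTheory.KZero.map (thickeningMap 𝒳 (Nat.le_add_left 1 (N + 1))) z = M • y₁ := by
    intro N
    obtain ⟨z, hz⟩ := hM (N + 1)
    refine ⟨z, map_specialFibreToThickening_zero_injective 𝒳 ?_⟩
    rw [← KTheory.KZero.map_comp_apply, specialFibreToThickening_comp_thickeningMap, hz, map_zsmul,
      hy₁]
  -- the compatible family of obstruction classes of `y₁`, killed by `M`, vanishes
  have hob : ∀ N, ob N y₁ = 0 := by
    refine hP M hM0 (fun N => ob N y₁) (fun N => hcompat N y₁) (fun N => ?_)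
    obtain ⟨z, hz⟩ := hMy N
    rw [← map_zsmul, ← hz]
    exact hzero N z
  intro n
  cases n with
  | zero => exact ⟨y₁, hy₁⟩
  | succ N =>
    obtain ⟨z, hz⟩ := hexact N y₁ (hob N)
    exact ⟨z, by rw [← specialFibreToThickening_comp_thickeningMap 𝒳 (Nat.le_add_left 1 (N + 1)),
      KTheory.KZero.map_comp_apply, hz, hy₁]⟩

end

end Summit.HodgeConjecture.HodgeConjecture.Theorems.FormalLiftingFromClassLifting.HuLine
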